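import Summits.BirchSwinnertonDyer.BirchSwinnertonDyer.Theses.QuadraticBranchSignedControl
import Summits.BirchSwinnertonDyer.Rank1Residual.Additive.QuadraticBranchPlusLFunctionExistence
import Summits.BirchSwinnertonDyer.Rank1Residual.Additive.QuadraticBranchPeriodRatioOfManinFact
import HarnessLib

/-!
# Route `QuadraticBranchSignedControl` (rung K8, cell `bsd-potss`), crux `EtaTransportSigned`
# (item stmt-BirchSwinnertonDyer-19115), registered stub `stub_etaMC_minus`: the MINUS (odd)
# `η`-component frame is the PLUS one + Kobayashi's Thm. 7.4 at `η` (+ Mazur's `p ∤ c₀`)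

WHAT. The registered stub `stub_etaMC_minus` (= the second conjunct of `EtaTransportSigned`,
verbatim below) asks: from the typed `F`-form (C1_η) `QuadraticBranchPlusMainConjectureAt V p`
(Kobayashi's EVEN = plus main conjecture for the good `a_p = 0` curve `V` on the quadratic
branch), deduce the ODD main conjecture at `η` for `V`: `Char X⁻(V/K_∞)^η = (X⁻¹ L_p⁻(V, η, X))`
on every dual datum `EtaSignedSelmerDualData V κ K₀ ℚ_[p] η γ (-1)`. FINDING (this seat, for the
planner): the passage plus ⟹ minus is NOT the signed base change of the plan's "dischargeable by
the signed base change `F_∞/ℚ_∞`" — (C1_η) speaks of the PLUS Selmer groups only; what turns the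
even main conjecture at `η` into the odd one at `η` is **Kobayashi's Theorem 7.4** ("the three
conjectures, namely, Kato's main conjecture, the even main conjecture and the odd main conjecture
are equivalent", Invent. Math. 152 (2003) p. 13), whose printed proof is component by component:
for each character `η` of `Δ` the three exact sequences
`0 → H¹(T)^η/Z(T)^η → Λ^η/L_p⁺(E, η, X) → X⁺(E/K_∞)^η → X⁰(E/K_∞)^η → 0`,
`0 → H¹(T)^η/Z(T)^η → I^η/L_p⁻(E, η, X) → X⁻(E/K_∞)^η → X⁰(E/K_∞)^η → 0` (`η ≠ 1`) of Thm. 6.2,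
6.3, (7.21), and Prop. 7.1 ii) — Coleman maps and Kato's Euler system, i.e. a deep published
theorem, not formalised. So the stub is `stub_etaMC_plus` + [Thm. 7.4 (ii) ⟹ (iii) at
`η = ω^{(p−1)/2}`], and this file proves exactly that reduction: the minus conjunct from
(a) the plus conjunct `hplus` (= `stub_etaMC_plus`, itself (C1_η) + the descent frame of
`QuadraticBranchSignedControlEtaTransportPlusOfDecomposition.lean`), (b) the DISPLAYED frame
`h74` = Thm. 7.4 (ii) ⟹ (iii) at `η` on the cell's objects (hypotheses: plus AND minus branch
functions `L⁺`, `L⁻` of the newform `f` of `V` with their period ratios, Kobayashi (3.4)/(3.6) and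
(3.5)/(3.7); the even statement at `η` for every plus dual datum; conclusion: the odd statement at
`η`), and (c) Mazur's `p ∤ c₀` (`ModularForms.mazur_not_dvd_maninConstant_of_odd`, ALREADY a conjunct
of the route's `PublishedInputsGss2`), needed only to EXHIBIT a plus branch function
`L_p⁺(V, η, X) ∈ Λ` (Kobayashi Thm. 3.2 = Pollack, tree theorem
`exists_isQuadraticBranchPlusLFunction_of_isNewformOf`, which wants a `p`-integral period ratio:
x1b's `periodRatio_of_mazur`) so that `hplus` can be invoked — the minus conjunct's binders carry
only the minus function.

HONEST FRAMING (cell `bsd-potss`, run/shared/lean/pub/bsd-potss/; FULL-BSD rank ≤ 1 programme):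
TOOL THEOREM ONLY — no definition, no named Literature fact introduced, no `sorry`, axioms
standard. CONDITIONAL on `hplus`, on the displayed frame `h74` (a THEOREM IN PRINT read on the
tree's objects, NOT formalised — WANTED on the cell bus as the named reading
«Kobayashi 2003 Thm. 7.4 (ii) ⟹ (iii) at η»; its Literature home cannot be a `Literature/` file
because its objects `EtaSignedSelmerDualData`, `IsQuadraticBranch{Plus,Minus}LFunction` are
Summits-side vocabulary) and on Mazur's named fact `hM`. Nothing is closed or booked by this file;
no label or count moves; `BSD(W, p)` is claimed for no pair. Seat `bsd-potss-k8q-c3` (prover), g0.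

References: [Kobayashi2003] §4 p. 8 (even / odd main conjectures at `η`; (3.7): `X ∣ L_p⁻(E, η, X)`
for `η ≠ 1`), Thm. 7.4 and its proof (p. 13), Thm. 6.2, 6.3, (7.21), Prop. 7.1 ii), Thm. 3.2 (p. 7);
[Mazur1978] Cor. 4.1; [GreenbergVatsal2000] §3 Rem. 3.4 (period normalisation).
-/

set_option autoImplicit false
set_option linter.dupNamespace false

noncomputable section

open scoped Classical MatrixGroups ModularForm

open CongruenceSubgroup Field WeierstrassCurve
open Literature.NumberTheory.EllipticCurves
open Literature.NumberTheory.EllipticCurves.ModularForms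
open Literature.NumberTheory.EllipticCurves.Kobayashi2003 hiding EtaSignedSelmerDualData IsQuadraticBranchPlusLFunction
  IsQuadraticBranchMinusLFunction
open Literature.NumberTheory.GaloisRepresentations
open Summit.BirchSwinnertonDyer.Rank1Residual.Additive
open Summit.BirchSwinnertonDyer.BirchSwinnertonDyer.Theses.QuadraticBranchSignedControl

namespace Summit.BirchSwinnertonDyer.BirchSwinnertonDyer.Theorems

/-- **Stub `stub_etaMC_minus` of crux `EtaTransportSigned` = the plus conjunct + Kobayashi's
Thm. 7.4 (ii) ⟹ (iii) at `η` (+ Mazur's `p ∤ c₀` to exhibit `L_p⁺(V, η, X)`).** The statement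
after the three hypotheses is the registered stub signature `Sig.stub_etaMC_minus` verbatim (= the
second conjunct of
`Summit.BirchSwinnertonDyer.BirchSwinnertonDyer.Theses.QuadraticBranchSignedControl.EtaTransportSigned`).
Hypotheses: `hM` — Mazur 1978 Cor. 4.1 (named fact, a conjunct of `PublishedInputsGss2`);
`hplus` — the plus conjunct of `EtaTransportSigned` (the registered stub `stub_etaMC_plus`);
`h74` — the DISPLAYED frame «even main conjecture at `η` ⟹ odd main conjecture at `η`» for a good
`a_p = 0` curve `V/ℚ`, `p` odd, read on the cell's objects: for the newform `f` of `V`, ANY plus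
branch function `L⁺` (Kobayashi (3.4)+(3.6) with its period ratio `ϖ₁`) and ANY minus branch
function `L⁻` ((3.5)+(3.7) with `ϖ₂`), if every Pontryagin-dual datum of `Sel⁺(V/K_∞)^η` is
finitely generated torsion with `Char = (L⁺)`, then every dual datum of `Sel⁻(V/K_∞)^η` has
`Char = (L⁻/X)` — Kobayashi's Thm. 7.4, whose proof (p. 13) is `η`-component by `η`-component.
Proof: `periodRatio_of_mazur` gives a `p`-integral period ratio `ϖ₁`,
`exists_isQuadraticBranchPlusLFunction_of_isNewformOf` a plus function `L⁺` for it, `hplus` the even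
statement at `η` for every plus datum, and `h74` concludes. CONDITIONAL on all three; nothing about
the printed theorems is asserted. [cite: Kobayashi2003, Thm. 7.4 and its proof (p. 13); §4 p. 8; Thm. 3.2 (p. 7)]
[cite: Mazur1978, Cor. 4.1] -/
theorem etaTransportMinus_of_plus_of_thm74 (hM : mazur_not_dvd_maninConstant_of_odd)
    (hplus : ∀ (p : ℕ) [Fact p.Prime], 5 ≤ p →
      ∀ (K₀ : Type) [Field K₀] [NumberField K₀] [IsCyclotomicExtension {p} ℚ K₀]
        [(galRange (K := ℚ) K₀).Normal] (ηq : absoluteGaloisGroup ℚ →* ℤˣ),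
        (∀ σ ∈ galRange (K := ℚ) K₀, ηq σ = 1) → ηq ≠ 1 →
      ∀ (V : WeierstrassCurve ℚ) [V.IsElliptic] [V.IsGloballyMinimal] {N : ℕ} [NeZero N]
        {f : CuspForm (Gamma0 N) 2},
        p ≠ 2 → V.HasGoodReductionAtPrime p → V.frobeniusTrace p = 0 →
        QuadraticBranchPlusMainConjectureAt V p → IsNewformOf V f →
      ∀ (ϖ : ℚ), (if Even (p / 2) then (ϖ : ℝ) * V.realPeriodRat = plusPeriod f
          else (ϖ : ℝ) * V.imaginaryPeriodRat = minusPeriod f) →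
      ∀ (Lη : IwasawaAlgebra p), IsQuadraticBranchPlusLFunction f p ϖ Lη →
      ∀ (κ : ZpExtension ℚ p) (γ : absoluteGaloisGroup ℚ),
        κ.IsCyclotomic → κ.IsTopGenerator γ → γ ∈ galRange (K := ℚ) K₀ →
        IsCyclotomicVariable p γ →
      ∀ (D : EtaSignedSelmerDualData V κ K₀ ℚ_[p] ηq γ 1),
        Module.Finite (IwasawaAlgebra p) D.X ∧ Module.IsTorsion (IwasawaAlgebra p) D.X ∧
          D.charIdeal = Ideal.span {Lη})
    (h74 : ∀ (p : ℕ) [Fact p.Prime], 5 ≤ p →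
      ∀ (K₀ : Type) [Field K₀] [NumberField K₀] [IsCyclotomicExtension {p} ℚ K₀]
        [(galRange (K := ℚ) K₀).Normal] (ηq : absoluteGaloisGroup ℚ →* ℤˣ),
        (∀ σ ∈ galRange (K := ℚ) K₀, ηq σ = 1) → ηq ≠ 1 →
      ∀ (V : WeierstrassCurve ℚ) [V.IsElliptic] [V.IsGloballyMinimal] {N : ℕ} [NeZero N]
        {f : CuspForm (Gamma0 N) 2},
        p ≠ 2 → V.HasGoodReductionAtPrime p → V.frobeniusTrace p = 0 → IsNewformOf V f →
      ∀ (ϖ₁ : ℚ), (if Even (p / 2) then (ϖ₁ : ℝ) * V.realPeriodRat = plusPeriod f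
          else (ϖ₁ : ℝ) * V.imaginaryPeriodRat = minusPeriod f) →
      ∀ (Lplus : IwasawaAlgebra p), IsQuadraticBranchPlusLFunction f p ϖ₁ Lplus →
      ∀ (ϖ₂ : ℚ), (if Even (p / 2) then (ϖ₂ : ℝ) * V.realPeriodRat = plusPeriod f
          else (ϖ₂ : ℝ) * V.imaginaryPeriodRat = minusPeriod f) →
      ∀ (Lminus : IwasawaAlgebra p), IsQuadraticBranchMinusLFunction f p ϖ₂ Lminus →
      ∀ (κ : ZpExtension ℚ p) (γ : absoluteGaloisGroup ℚ),
        κ.IsCyclotomic → κ.IsTopGenerator γ → γ ∈ galRange (K := ℚ) K₀ →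
        IsCyclotomicVariable p γ →
      (∀ D : EtaSignedSelmerDualData V κ K₀ ℚ_[p] ηq γ 1,
        Module.Finite (IwasawaAlgebra p) D.X ∧ Module.IsTorsion (IwasawaAlgebra p) D.X ∧
          D.charIdeal = Ideal.span {Lplus}) →
      ∀ (D : EtaSignedSelmerDualData V κ K₀ ℚ_[p] ηq γ (-1)) (L' : IwasawaAlgebra p),
        Lminus = PowerSeries.X * L' → D.charIdeal = Ideal.span {L'}) :
    ∀ (p : ℕ) [Fact p.Prime], 5 ≤ p →
    ∀ (K₀ : Type) [Field K₀] [NumberField K₀] [IsCyclotomicExtension {p} ℚ K₀]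
      [(galRange (K := ℚ) K₀).Normal] (ηq : absoluteGaloisGroup ℚ →* ℤˣ),
      (∀ σ ∈ galRange (K := ℚ) K₀, ηq σ = 1) → ηq ≠ 1 →
    ∀ (V : WeierstrassCurve ℚ) [V.IsElliptic] [V.IsGloballyMinimal] {N : ℕ} [NeZero N]
      {f : CuspForm (Gamma0 N) 2},
      p ≠ 2 → V.HasGoodReductionAtPrime p → V.frobeniusTrace p = 0 →
      QuadraticBranchPlusMainConjectureAt V p → IsNewformOf V f →
    ∀ (ϖ : ℚ), (if Even (p / 2) then (ϖ : ℝ) * V.realPeriodRat = plusPeriod f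
        else (ϖ : ℝ) * V.imaginaryPeriodRat = minusPeriod f) →
    ∀ (Lη : IwasawaAlgebra p), IsQuadraticBranchMinusLFunction f p ϖ Lη →
    ∀ (κ : ZpExtension ℚ p) (γ : absoluteGaloisGroup ℚ),
      κ.IsCyclotomic → κ.IsTopGenerator γ → γ ∈ galRange (K := ℚ) K₀ →
      IsCyclotomicVariable p γ →
    ∀ (D : EtaSignedSelmerDualData V κ K₀ ℚ_[p] ηq γ (-1)) (L' : IwasawaAlgebra p),
      Lη = PowerSeries.X * L' → D.charIdeal = Ideal.span {L'} := by
  intro p _ hp5 K₀ _ _ _ _ ηq hηK hη1 V _ _ N _ f hp2 hgood hap h1 hf ϖ hϖ Lη hL κ γ hκ hγ hγK hγc D L'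
    hLL'
  -- a `p`-integral period ratio (Mazur) and a plus branch function for it (Kobayashi Thm. 3.2)
  obtain ⟨ϖ₁, hϖ₁int, hϖ₁⟩ := periodRatio_of_mazur p hM hp5 V f hf hgood hap
  obtain ⟨Lplus, hLplus⟩ :=
    exists_isQuadraticBranchPlusLFunction_of_isNewformOf hp2 hf hgood hap ϖ₁ hϖ₁int
  -- the even main conjecture at `η`, from (C1_η), by the plus conjunct
  have heven : ∀ D : EtaSignedSelmerDualData V κ K₀ ℚ_[p] ηq γ 1,
      Module.Finite (IwasawaAlgebra p) D.X ∧ Module.IsTorsion (IwasawaAlgebra p) D.X ∧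
        D.charIdeal = Ideal.span {Lplus} :=
    fun Dp => hplus p hp5 K₀ ηq hηK hη1 V hp2 hgood hap h1 hf ϖ₁ hϖ₁ Lplus hLplus κ γ hκ hγ hγK hγc Dp
  -- Kobayashi Thm. 7.4 (ii) ⟹ (iii) at `η`
  exact h74 p hp5 K₀ ηq hηK hη1 V hp2 hgood hap hf ϖ₁ hϖ₁ Lplus hLplus ϖ hϖ Lη hL κ γ hκ hγ hγK hγc
    heven D L' hLL'

end Summit.BirchSwinnertonDyer.BirchSwinnertonDyer.Theorems

end
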